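/-
Copyright (c) 2026 the pub-hodgecm-mathlib formalisation cell (harness21).  Prover seat hodgecm-mathlib-LH4-p14 (g9) (L1 valve hand; LEAD F0P6-plan (g16) BATCH #280 (2),
(dec-2-pay) F2, sub-brick F2β), Track B «K2-LIT» ∕ hLiu418 #184♮, socket #41 KIND 1, package (K1b-♮): THE FRAME READING OF THE CORNER — how the doubled LINE
`U(1,1)`, embedded in `U(2,2)` by Kudla's see-saw chart `blkD (1, ·)`, reads in the Levi-ADAPTED tube frames `T′` of ★ `K2LiuKindOneLineLeviFramesOfRecord`.
THEOREMS ONLY (no `def`, no `instance`, no notation, no named-fact hypothesis, no `sorry`, default heartbeats).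
-/
import Summits.HodgeConjecture.HodgeConjecture.Theorems.K2LiuBlockDiagPlaces              -- ★ (e2) `coe_archPart_blkD` (the archimedean component of `blkD (h₁, h₂)`)
import Summits.HodgeConjecture.HodgeConjecture.Theorems.K2LiuSiegelUnipotentArchPlaces     -- ★ `coe_archAt_eq_map` (brings `archAt`, `archPart`)
import HarnessLib

/-!
# Crux `HLiu418`, socket #41, KIND 1 (K1-b♮), (dec-2-pay) F2β — `K2LiuKindOneLineCornerFrameReading`: THE CORNER IN THE ADAPTED TUBE FRAME

Cell `hodgecm-mathlib`, hLiu418 = `stmt-HodgeConjecture-24832` (helper lane, count-neutral); squad K2 ∕ K2Liu, socket #41, KIND 1.  The K1-b♮ chain letter `hchain₁`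
of ★ p865057 `K2LiuKindOneLineBlockLetterOfRecord.blockLetter_rate_of_record` (F1) reads the pulled-back LINE family `y ↦ f_s(blkD(1,y)·g)` place by place as
`Finf i σ s (ι(J₁·n₁ t) · (T′σ·(g)_σ·T′σ⁻¹))` — `ι` the corner pattern `ι x = [[1,0;0,x₁₁],[0,0;0,x₁₂];[0,0;0,x₂₁],[1,0;0,x₂₂]]`, `T′σ` the Levi-ADAPTED frames of
★ p864905 (closed forms (9)(10): `T′ = m(D⁻¹)·[[D, D],[iεD, −iεD]]`, `D = diag(√(|t_k|∕2))`, `ε = sgn t_k`, `t_k = Re σ(dV_{e⁻¹k,1}·dW_{e⁻¹k,2})`).  Frame algebra for F2: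
* §1 ONE DIAGONAL SLOT (`Fin 1 ⊕ Fin 1`; letters `c = i·sgn t` with `c² = −1`, `τ = |t|∕2`, `τ′ = τ⁻¹`): the slot of (9)(10) multiplied out is
  `T′₁ = [[1, 1],[cτ, −cτ]]`, `T′₁⁻¹ = [[½, −cτ′∕2],[½, cτ′∕2]]` (§4 `adaptedFrame(Inv)_eq_blockDiagonal`); `slotFrame_mul_slotFrameInv` ∕ `slotFrameInv_mul_slotFrame`, **`slotFrame_conj_weyl`** — the line's
  Weyl element `diag(1,−1)` (★ `blk_weylDelta`) reads `[[0, −cτ′],[cτ, 0]] = c • (J₁ · m(τ))` (`weylSlot_eq_smul_J_mul_levi`; NOT a multiple of `J₁`: the ADAPTED frame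
  costs the Levi factor `m(τ) = diag(τ, τ′)`), **`slotFrame_conj_unip`** — a line unipotent `[[1−X, X],[−X, 1+X]]` (★ `mem_unipDelta_iff`) reads `[[1, 2cτ′X],[0, 1]]`,
  and **`J_mul_unip_mul_levi`** `J₁·n₁(y)·m(a) = m(a′)·J₁·n₁(a′²·y)` (`aa′ = 1`): the Levi factor moves to the LEFT of `J₁ n₁`, where the Siegel-section law of
  `Finf` makes it a constant, at the price of rescaling the unipotent — so in F1's literal shape `ι(J₁·n₁ t)·G` the archimedean frequency at `σ` is
  `(|t₁|_σ∕2)·|σf|_σ` up to the universal convention constant (F1 ED. 2: per-place `lam σ`, K2 bus 2026-09-05T03:38:41Z).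
* §2 THE INDEX SHUFFLE (`eV (1,0) = 1`: the `B`-line is the SECOND index): `idxSplit_of_he`, **`reindex_blockDiag_one_eq_corner`** `e₂⁻¹·σ_D⁻¹[diag(1, Y)]·e₂ = ι(e₂⁻¹·Y·e₂)`.
* §3 FRAMES DIAGONAL IN THE SLOTS: `blockDiagonal_mul`, **`blockDiagonalFrame_conj_corner`** `T·ι(x)·T⁻ = ι(T₁·x·T₁⁻)` (slot-`0` pieces mutually inverse).
* §4 `adaptedFrame(Inv)_eq_blockDiagonal` ((9)(10) ARE diagonal in the slots), **`reindex_archAt_blkD_one`** `e₂⁻¹·((blkD(1,y))_∞)_σ·e₂ = ι(e₂⁻¹·(y_∞)_σ·e₂)`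
  (★ `coe_archPart_blkD_inr`, ★ `coe_archAt_eq_map`), and the HEAD **`frame_archAt_blkD_one_adapted`**: at the frames (9)(10) BY VALUE, for every complex `σ` and
  `y ∈ H_B(𝔸)`, `T′σ · (e₂⁻¹·((blkD(1,y))_∞)_σ·e₂) · T′σ⁻¹ = ι(T′₁σ · (e₂⁻¹·(y_∞)_σ·e₂) · T′₁σ⁻¹)` with `T′₁σ` the slot-`1` frame at `t := t₁(σ)` (`= Re σ(dB₀·dW₀)`, `dVdW_slot_one`).
[Kudla1994, §2] [BorelJacquet1979, §4.1] [Shimura1997, §18.1 (18.4), §A3] [HarrisKudlaSweet1996, §1 (1.11)].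
HONEST LABEL.  Count-neutral helper (matrix algebra + place components); closes no socket: `HC_CM` is proved only modulo the 7 printed citations (2 remaining named
inputs: hLiu418 = `stmt-HodgeConjecture-24832`, h413 = `stmt-HodgeConjecture-24833`) until rung 0 closes.

## References
* [Kudla1994] S. Kudla, *Splitting metaplectic covers of dual reductive pairs*, Israel J. Math. 87 (1994), §2.  [BorelJacquet1979] A. Borel, H. Jacquet, PSPM 33.1 (1979), §4.1.
* [Shimura1997] G. Shimura, *Euler Products and Eisenstein Series*, CBMS 93 (1997), §18.1 (18.4), §A3.  [HarrisKudlaSweet1996] M. Harris, S. Kudla, W. Sweet, J. AMS 9 (1996), §1 (1.11).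
-/

set_option autoImplicit false
set_option linter.dupNamespace false -- the mandated namespace repeats `HodgeConjecture.HodgeConjecture`

noncomputable section

open scoped Classical
open scoped Matrix
open Complex Matrix NumberField IsDedekindDomain
open Literature.NumberTheory.Automorphic Literature.NumberTheory.GaloisRepresentations
open Literature.NumberTheory.GelbartRogawski1991 Literature.NumberTheory.GelbartRogawski1991.GRConstruction
open Literature.NumberTheory.GelbartRogawski1991.UnitaryDualPair

namespace Summit.HodgeConjecture.HodgeConjecture.Cruxes.HLiu418.K2LiuKindOneLineCornerFrameReading

/-! ## §1 One diagonal slot of the adapted frame (`ρ = √(|t|∕2)`, `ρ′ρ = 1`, `s = sgn t`; multiplied out: `c := i·s`, `c² = −1`, `τ := ρ²`, `τ′ := ρ′²`, `ττ′ = 1`) -/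

section Slot

/-- the slot letters: `c := i·s` has `c² = −1` when `s² = 1`; `τ := ρ²`, `τ′ := ρ′²` have `ττ′ = 1` when `ρ′ρ = 1`. [folklore] -/
theorem slot_letters {ρ ρ' s : ℂ} (hρ : ρ' * ρ = 1) (hs : s * s = 1) :
    I * s * (I * s) = -1 ∧ ρ * ρ * (ρ' * ρ') = 1 := by
  constructor
  · linear_combination (s * s) * Complex.I_mul_I + (-1 : ℂ) * hs
  · linear_combination (ρ' * ρ + 1) * hρ

variable {c τ τ' : ℂ}

/-- **`T′₁ · T′₁⁻¹ = 1`** for `T′₁ = [[1, 1],[cτ, −cτ]]`, `T′₁⁻¹ = [[½, −cτ′∕2],[½, cτ′∕2]]` (`c² = −1`, `ττ′ = 1`). [cite: Shimura1997, §A3] -/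
theorem slotFrame_mul_slotFrameInv (hc : c * c = -1) (hτ : τ * τ' = 1) :
    (fromBlocks !![1] !![1] !![c * τ] !![-(c * τ)] : Matrix (Fin 1 ⊕ Fin 1) (Fin 1 ⊕ Fin 1) ℂ) *
      fromBlocks !![1 / 2] !![-(c * τ' / 2)] !![1 / 2] !![c * τ' / 2] = 1 := by
  ext i j
  rcases i with i | i <;> rcases j with j | j <;> fin_cases i <;> fin_cases j
  · simp [Matrix.mul_apply, Fintype.sum_sum_type, fromBlocks, one_apply]; ring
  · simp [Matrix.mul_apply, Fintype.sum_sum_type, fromBlocks, one_apply]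
  · simp [Matrix.mul_apply, Fintype.sum_sum_type, fromBlocks, one_apply]
  · simp [Matrix.mul_apply, Fintype.sum_sum_type, fromBlocks, one_apply]
    linear_combination (-(τ * τ')) * hc + hτ

/-- **`T′₁⁻¹ · T′₁ = 1`** (`c² = −1`, `ττ′ = 1`). [cite: Shimura1997, §A3] -/
theorem slotFrameInv_mul_slotFrame (hc : c * c = -1) (hτ : τ * τ' = 1) :
    (fromBlocks !![1 / 2] !![-(c * τ' / 2)] !![1 / 2] !![c * τ' / 2] : Matrix (Fin 1 ⊕ Fin 1) (Fin 1 ⊕ Fin 1) ℂ) *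
      fromBlocks !![1] !![1] !![c * τ] !![-(c * τ)] = 1 := by
  ext i j
  rcases i with i | i <;> rcases j with j | j <;> fin_cases i <;> fin_cases j
  · simp [Matrix.mul_apply, Fintype.sum_sum_type, fromBlocks, one_apply]
    linear_combination (-(τ * τ' / 2)) * hc + (1 / 2 : ℂ) * hτ
  · simp [Matrix.mul_apply, Fintype.sum_sum_type, fromBlocks, one_apply]
    linear_combination (τ * τ' / 2) * hc + (-(1 / 2 : ℂ)) * hτ
  · simp [Matrix.mul_apply, Fintype.sum_sum_type, fromBlocks, one_apply]
    linear_combination (τ * τ' / 2) * hc + (-(1 / 2 : ℂ)) * hτ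
  · simp [Matrix.mul_apply, Fintype.sum_sum_type, fromBlocks, one_apply]
    linear_combination (-(τ * τ' / 2)) * hc + (1 / 2 : ℂ) * hτ

/-- **THE LINE'S WEYL ELEMENT IN THE ADAPTED SLOT FRAME**: `T′₁ · diag(1,−1) · T′₁⁻¹ = [[0, −cτ′],[cτ, 0]]` (★ `blk_weylDelta`: `blk w_Δ = diag(1,−1)`; this is
`c • (J₁·m(τ))`, NOT a multiple of `J₁` — the adapted frame picks up the Levi factor `m(τ) = diag(τ, τ′)`; the KW frame `T₄` has `τ = 1`). [cite: Shimura1997, §18.1, §A3] -/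
theorem slotFrame_conj_weyl (c τ τ' : ℂ) :
    (fromBlocks !![1] !![1] !![c * τ] !![-(c * τ)] : Matrix (Fin 1 ⊕ Fin 1) (Fin 1 ⊕ Fin 1) ℂ) * fromBlocks 1 0 0 (-1) *
        fromBlocks !![1 / 2] !![-(c * τ' / 2)] !![1 / 2] !![c * τ' / 2] =
      fromBlocks 0 !![-(c * τ')] !![c * τ] 0 := by
  ext i j
  rcases i with i | i <;> rcases j with j | j <;> fin_cases i <;> fin_cases j
  · simp [Matrix.mul_apply, Fintype.sum_sum_type, fromBlocks, one_apply]
  · simp [Matrix.mul_apply, Fintype.sum_sum_type, fromBlocks, one_apply]; ring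
  · simp [Matrix.mul_apply, Fintype.sum_sum_type, fromBlocks, one_apply]; ring
  · simp [Matrix.mul_apply, Fintype.sum_sum_type, fromBlocks, one_apply]

/-- the same, factored: `[[0, −cτ′],[cτ, 0]] = c • (J₁ · m(τ))`, `J₁ = fromBlocks 0 (−1) 1 0`, `m(τ) = diag(τ, τ′)`. [cite: HarrisKudlaSweet1996, §1 (1.11)] -/
theorem weylSlot_eq_smul_J_mul_levi (c τ τ' : ℂ) :
    (fromBlocks 0 !![-(c * τ')] !![c * τ] 0 : Matrix (Fin 1 ⊕ Fin 1) (Fin 1 ⊕ Fin 1) ℂ) =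
      c • (Matrix.J (Fin 1) ℂ * fromBlocks !![τ] 0 0 !![τ']) := by
  rw [Matrix.J]
  ext i j
  rcases i with i | i <;> rcases j with j | j <;> fin_cases i <;> fin_cases j <;>
    simp [Matrix.mul_apply, Fintype.sum_sum_type, fromBlocks]

/-- **A LINE UNIPOTENT IN THE ADAPTED SLOT FRAME**: the raw block matrix `[[1−X, X],[−X, 1+X]]` (= `E₁⁻¹·[1 X; 0 1]·E₂⁻¹`, ★ `mem_unipDelta_iff`) reads
`T′₁ · [[1−X, X],[−X, 1+X]] · T′₁⁻¹ = [[1, 2cτ′·X],[0, 1]]` (`c² = −1`, `ττ′ = 1`). [cite: Shimura1997, §18.1 (18.4)] [cite: Kudla1994, §2] -/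
theorem slotFrame_conj_unip (hc : c * c = -1) (hτ : τ * τ' = 1) (x : ℂ) :
    (fromBlocks !![1] !![1] !![c * τ] !![-(c * τ)] : Matrix (Fin 1 ⊕ Fin 1) (Fin 1 ⊕ Fin 1) ℂ) * fromBlocks !![1 - x] !![x] !![-x] !![1 + x] *
        fromBlocks !![1 / 2] !![-(c * τ' / 2)] !![1 / 2] !![c * τ' / 2] =
      fromBlocks 1 !![2 * c * τ' * x] 0 1 := by
  ext i j
  rcases i with i | i <;> rcases j with j | j <;> fin_cases i <;> fin_cases j
  · simp [Matrix.mul_apply, Fintype.sum_sum_type, fromBlocks, one_apply]; ring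
  · simp [Matrix.mul_apply, Fintype.sum_sum_type, fromBlocks]; ring
  · simp [Matrix.mul_apply, Fintype.sum_sum_type, fromBlocks]; ring
  · simp [Matrix.mul_apply, Fintype.sum_sum_type, fromBlocks, one_apply]
    linear_combination (-(τ * τ')) * hc + hτ

/-- **THE LEVI COMMUTATION** in `U(1,1)` (`Fin 1 ⊕ Fin 1`): `J₁ · n₁(y) · m(a) = m(a′) · J₁ · n₁(a′²·y)` for `aa′ = 1` (`n₁(y) = [[1, y],[0, 1]]`,
`m(a) = diag(a, a′)`) — the Levi factor moves to the LEFT of the Weyl element at the price of rescaling the unipotent. [cite: HarrisKudlaSweet1996, §1 (1.11)] -/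
theorem J_mul_unip_mul_levi {a a' : ℂ} (ha : a * a' = 1) (y : ℂ) :
    Matrix.J (Fin 1) ℂ * fromBlocks 1 !![y] 0 1 * fromBlocks !![a] 0 0 !![a'] =
      fromBlocks !![a'] 0 0 !![a] * Matrix.J (Fin 1) ℂ * fromBlocks 1 !![a' * a' * y] 0 1 := by
  rw [Matrix.J]
  ext i j
  rcases i with i | i <;> rcases j with j | j <;> fin_cases i <;> fin_cases j
  · simp [Matrix.mul_apply, Fintype.sum_sum_type, fromBlocks]
  · simp [Matrix.mul_apply, Fintype.sum_sum_type, fromBlocks]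
  · simp [Matrix.mul_apply, Fintype.sum_sum_type, fromBlocks]
  · simp [Matrix.mul_apply, Fintype.sum_sum_type, fromBlocks]
    linear_combination (-(a' * y)) * ha

end Slot

/-! ## §2 The index shuffle: with `eV (1,0) = 1` the see-saw chart puts the `B`-line at the SECOND index of each copy -/

section Index

variable {n₁ n₂ : ℕ} (eV : Fin 2 × Fin 1 ≃ Fin 2) (eA : Fin 1 × Fin 1 ≃ Fin n₁) (eB : Fin 1 × Fin 1 ≃ Fin n₂)

/-- `eV⁻¹ 1 = (1, 0)` and `eV⁻¹ 0 = (0, 0)` when `eV (1,0) = 1`. [folklore] -/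
theorem eV_symm_of_he (he : eV (1, 0) = 1) : eV.symm 1 = (1, 0) ∧ eV.symm 0 = (0, 0) := by
  have h1 : eV.symm 1 = (1, 0) := by rw [Equiv.symm_apply_eq]; exact he.symm
  refine ⟨h1, ?_⟩
  have h0 : eV (0, 0) ≠ 1 := fun h => by
    have := eV.injective (h.trans he.symm)
    simp at this
  rw [Equiv.symm_apply_eq]
  rcases Fin.eq_zero_or_eq_succ (eV (0, 0)) with h | ⟨j, hj⟩
  · exact h.symm
  · exfalso; apply h0; rw [hj]; exact congrArg Fin.succ (Fin.eq_zero j) |>.trans rfl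

/-- **`idxSplit eV eA eB 1 = inr (eB (0,0))`** (the `B`-line is the second index) and **`idxSplit eV eA eB 0 = inl (eA (0,0))`**, when `eV (1,0) = 1`.
[cite: Kudla1994, §2] -/
theorem idxSplit_of_he (he : eV (1, 0) = 1) :
    idxSplit eV eA eB 1 = Sum.inr (eB (0, 0)) ∧ idxSplit eV eA eB 0 = Sum.inl (eA (0, 0)) := by
  obtain ⟨h1, h0⟩ := eV_symm_of_he eV he
  have e1 : (finSumFinEquiv (m := 1) (n := 1)).symm 1 = Sum.inr 0 :=
    (finSumFinEquiv_symm_apply_natAdd (m := 1) (n := 1) 0).trans rfl |>.symm.symm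
  have e0 : (finSumFinEquiv (m := 1) (n := 1)).symm 0 = Sum.inl 0 :=
    finSumFinEquiv_symm_apply_castAdd (m := 1) (n := 1) 0
  constructor
  · simp [idxSplit, h1, e1]
  · simp [idxSplit, h0, e0]

variable (ι : Matrix (Fin 1 ⊕ Fin 1) (Fin 1 ⊕ Fin 1) ℂ → Matrix (Fin 2 ⊕ Fin 2) (Fin 2 ⊕ Fin 2) ℂ)
    (hι : ∀ x, ι x = fromBlocks !![1, 0; 0, x (Sum.inl 0) (Sum.inl 0)] !![0, 0; 0, x (Sum.inl 0) (Sum.inr 0)] !![0, 0; 0, x (Sum.inr 0) (Sum.inl 0)] !![1, 0; 0, x (Sum.inr 0) (Sum.inr 0)])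

include hι in
/-- **THE SEE-SAW CHART OF `diag(1, Y)` READ ON `Fin 2 ⊕ Fin 2` IS THE CORNER**: `e₂⁻¹ · σ_D⁻¹[diag(1, Y)] · e₂ = ι(e₂⁻¹ · Y · e₂)` for `eV (1,0) = 1`
(`σ_D = idxSplitD eV eA eB`, ★ `idxSplitD_apply_inl∕inr`; here `n₁ = n₂ = 1`). [cite: Kudla1994, §2] -/
theorem reindex_blockDiag_one_eq_corner (eA eB : Fin 1 × Fin 1 ≃ Fin 1) (he : eV (1, 0) = 1) (Y : Matrix (Fin (1 + 1)) (Fin (1 + 1)) ℂ) :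
    Matrix.reindex (finSumFinEquiv (m := 2) (n := 2)).symm (finSumFinEquiv (m := 2) (n := 2)).symm
        (Matrix.reindex (idxSplitD eV eA eB).symm (idxSplitD eV eA eB).symm (fromBlocks (1 : Matrix (Fin (1 + 1)) (Fin (1 + 1)) ℂ) 0 0 Y)) =
      ι (Matrix.reindex (finSumFinEquiv (m := 1) (n := 1)).symm (finSumFinEquiv (m := 1) (n := 1)).symm Y) := by
  obtain ⟨h1, h0⟩ := idxSplit_of_he eV eA eB he
  have hA : eA (0, 0) = 0 := Fin.eq_zero _
  have hB : eB (0, 0) = 0 := Fin.eq_zero _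
  rw [hA] at h0
  rw [hB] at h1
  -- the four values of `σ_D ∘ e₂`
  have s0 : idxSplitD eV eA eB (finSumFinEquiv (Sum.inl 0)) = Sum.inl (finSumFinEquiv (m := 1) (n := 1) (Sum.inl 0)) := by
    rw [idxSplitD_apply_inl, h0, Sum.map_inl]
  have s1 : idxSplitD eV eA eB (finSumFinEquiv (Sum.inl 1)) = Sum.inr (finSumFinEquiv (m := 1) (n := 1) (Sum.inl 0)) := by
    rw [idxSplitD_apply_inl, h1, Sum.map_inr]
  have s2 : idxSplitD eV eA eB (finSumFinEquiv (Sum.inr 0)) = Sum.inl (finSumFinEquiv (m := 1) (n := 1) (Sum.inr 0)) := by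
    rw [idxSplitD_apply_inr, h0, Sum.map_inl]
  have s3 : idxSplitD eV eA eB (finSumFinEquiv (Sum.inr 1)) = Sum.inr (finSumFinEquiv (m := 1) (n := 1) (Sum.inr 0)) := by
    rw [idxSplitD_apply_inr, h1, Sum.map_inr]
  have one11 : (1 : Matrix (Fin (1 + 1)) (Fin (1 + 1)) ℂ) (finSumFinEquiv (Sum.inl 0)) (finSumFinEquiv (Sum.inl 0)) = 1 := one_apply_eq _
  have one22 : (1 : Matrix (Fin (1 + 1)) (Fin (1 + 1)) ℂ) (finSumFinEquiv (Sum.inr 0)) (finSumFinEquiv (Sum.inr 0)) = 1 := one_apply_eq _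
  have one12 : (1 : Matrix (Fin (1 + 1)) (Fin (1 + 1)) ℂ) (finSumFinEquiv (Sum.inl 0)) (finSumFinEquiv (Sum.inr 0)) = 0 :=
    one_apply_ne (by decide)
  have one21 : (1 : Matrix (Fin (1 + 1)) (Fin (1 + 1)) ℂ) (finSumFinEquiv (Sum.inr 0)) (finSumFinEquiv (Sum.inl 0)) = 0 :=
    one_apply_ne (by decide)
  rw [hι]
  ext i j
  rcases i with i | i <;> rcases j with j | j <;> fin_cases i <;> fin_cases j <;>
    simp [Matrix.reindex_apply, Matrix.submatrix_apply, fromBlocks, s0, s1, s2, s3, one11, one22, one12, one21]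

end Index

/-! ## §3 Frames diagonal in the slots conjugate the corner slot by slot -/

section BlockDiagonal

/-- a product of two frames diagonal in the slots is diagonal in the slots, with the slotwise `2 × 2` products. [folklore] -/
theorem blockDiagonal_mul {k : Type*} [Fintype k] [DecidableEq k] (a b c d a' b' c' d' : k → ℂ) :
    fromBlocks (diagonal a) (diagonal b) (diagonal c) (diagonal d) * fromBlocks (diagonal a') (diagonal b') (diagonal c') (diagonal d') =
      fromBlocks (diagonal fun i => a i * a' i + b i * c' i) (diagonal fun i => a i * b' i + b i * d' i)
        (diagonal fun i => c i * a' i + d i * c' i) (diagonal fun i => c i * b' i + d i * d' i) := by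
  rw [fromBlocks_multiply]
  simp only [diagonal_mul_diagonal, diagonal_add]

variable (ι : Matrix (Fin 1 ⊕ Fin 1) (Fin 1 ⊕ Fin 1) ℂ → Matrix (Fin 2 ⊕ Fin 2) (Fin 2 ⊕ Fin 2) ℂ)
    (hι : ∀ x, ι x = fromBlocks !![1, 0; 0, x (Sum.inl 0) (Sum.inl 0)] !![0, 0; 0, x (Sum.inl 0) (Sum.inr 0)] !![0, 0; 0, x (Sum.inr 0) (Sum.inl 0)] !![1, 0; 0, x (Sum.inr 0) (Sum.inr 0)])

include hι in
/-- **FRAMES DIAGONAL IN THE SLOTS CONJUGATE THE CORNER SLOT BY SLOT**: for `T = [[diag a, diag b],[diag c, diag d]]`, `T⁻ = [[diag a′, diag b′],[diag c′, diag d′]]`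
on `Fin 2 ⊕ Fin 2` whose slot-`0` `2 × 2` matrices are mutually inverse (`[[a 0, b 0],[c 0, d 0]]·[[a′ 0, b′ 0],[c′ 0, d′ 0]] = 1`, four scalar equations),
`T · ι(x) · T⁻ = ι([[a 1, b 1],[c 1, d 1]] · x · [[a′ 1, b′ 1],[c′ 1, d′ 1]])`. [cite: Kudla1994, §2] [cite: Shimura1997, §A3] -/
theorem blockDiagonalFrame_conj_corner (a b c d a' b' c' d' : Fin 2 → ℂ)
    (h00 : a 0 * a' 0 + b 0 * c' 0 = 1) (h01 : a 0 * b' 0 + b 0 * d' 0 = 0) (h10 : c 0 * a' 0 + d 0 * c' 0 = 0) (h11 : c 0 * b' 0 + d 0 * d' 0 = 1)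
    (x : Matrix (Fin 1 ⊕ Fin 1) (Fin 1 ⊕ Fin 1) ℂ) :
    fromBlocks (diagonal a) (diagonal b) (diagonal c) (diagonal d) * ι x * fromBlocks (diagonal a') (diagonal b') (diagonal c') (diagonal d') =
      ι ((fromBlocks !![a 1] !![b 1] !![c 1] !![d 1] : Matrix (Fin 1 ⊕ Fin 1) (Fin 1 ⊕ Fin 1) ℂ) * x * fromBlocks !![a' 1] !![b' 1] !![c' 1] !![d' 1]) := by
  rw [hι, hι]
  ext i j
  rcases i with i | i <;> rcases j with j | j <;> fin_cases i <;> fin_cases j <;>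
    simp [Matrix.mul_apply, Fintype.sum_sum_type, fromBlocks, diagonal, h00, h01, h10, h11]

end BlockDiagonal

/-! ## §4 The closed forms (9)(10) of ★ p864905 are diagonal in the slots, and the archimedean component of `blkD (1, y)` is the corner -/

section Adapted

/-- **(9) multiplied out**: `m(D⁻¹)·[[D, D],[C, −C]] = [[1, 1],[diag γ, −diag γ]]`, `γ_k = i·sg_k·ρ_k²` (`ρ_k = √(|t_k|∕2)`, `sg_k = t_k∕|t_k|`, `t_k ≠ 0`), in the LETTERS
of ★ p864905 (9). [cite: Shimura1997, §A3] -/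
theorem adaptedFrame_eq_blockDiagonal (t : Fin 2 → ℝ) (ht : ∀ k, t k ≠ 0) :
    (fromBlocks (diagonal fun k => (((Real.sqrt (|t k| / 2))⁻¹ : ℝ) : ℂ)) 0 0 (diagonal fun k => (Real.sqrt (|t k| / 2) : ℂ)) *
        fromBlocks (diagonal fun k => (Real.sqrt (|t k| / 2) : ℂ)) (diagonal fun k => (Real.sqrt (|t k| / 2) : ℂ))
          (diagonal fun k => I * (((t k / |t k|) * Real.sqrt (|t k| / 2) : ℝ) : ℂ)) (-diagonal fun k => I * (((t k / |t k|) * Real.sqrt (|t k| / 2) : ℝ) : ℂ)) :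
        Matrix (Fin 2 ⊕ Fin 2) (Fin 2 ⊕ Fin 2) ℂ) =
      fromBlocks (diagonal fun _ => (1 : ℂ)) (diagonal fun _ => (1 : ℂ))
        (diagonal fun k => I * ((t k / |t k| : ℝ) : ℂ) * ((Real.sqrt (|t k| / 2) : ℂ) * (Real.sqrt (|t k| / 2) : ℂ)))
        (diagonal fun k => -(I * ((t k / |t k| : ℝ) : ℂ) * ((Real.sqrt (|t k| / 2) : ℂ) * (Real.sqrt (|t k| / 2) : ℂ)))) := by
  have hρ : ∀ k, (((Real.sqrt (|t k| / 2))⁻¹ : ℝ) : ℂ) * (Real.sqrt (|t k| / 2) : ℂ) = 1 := fun k => by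
    have h1 : Real.sqrt (|t k| / 2) ≠ 0 := (Real.sqrt_pos.2 (by have := ht k; positivity)).ne'
    rw [← ofReal_mul, inv_mul_cancel₀ h1, ofReal_one]
  rw [show (0 : Matrix (Fin 2) (Fin 2) ℂ) = diagonal fun _ => (0 : ℂ) from diagonal_zero.symm, diagonal_neg, blockDiagonal_mul]
  simp only [zero_mul, add_zero, zero_add, hρ]
  congr 1 <;> (congr 1; funext k; push_cast; ring)

/-- **(10) multiplied out**: `½[[D⁻¹, C⁻¹],[D⁻¹, −C⁻¹]]·m(D) = [[½, −diag γ′∕2],[½, diag γ′∕2]]`, `γ′_k = i·sg_k·ρ_k⁻²`, in the LETTERS of ★ p864905 (10).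
[cite: Shimura1997, §A3] -/
theorem adaptedFrameInv_eq_blockDiagonal (t : Fin 2 → ℝ) (ht : ∀ k, t k ≠ 0) :
    (fromBlocks (diagonal fun k => (((Real.sqrt (|t k| / 2))⁻¹ / 2 : ℝ) : ℂ)) (-diagonal fun k => I * (((Real.sqrt (|t k| / 2))⁻¹ * (t k / |t k|) / 2 : ℝ) : ℂ))
          (diagonal fun k => (((Real.sqrt (|t k| / 2))⁻¹ / 2 : ℝ) : ℂ)) (diagonal fun k => I * (((Real.sqrt (|t k| / 2))⁻¹ * (t k / |t k|) / 2 : ℝ) : ℂ)) *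
        fromBlocks (diagonal fun k => (Real.sqrt (|t k| / 2) : ℂ)) 0 0 (diagonal fun k => (((Real.sqrt (|t k| / 2))⁻¹ : ℝ) : ℂ)) :
        Matrix (Fin 2 ⊕ Fin 2) (Fin 2 ⊕ Fin 2) ℂ) =
      fromBlocks (diagonal fun _ => (1 / 2 : ℂ))
        (diagonal fun k => -(I * ((t k / |t k| : ℝ) : ℂ) * ((((Real.sqrt (|t k| / 2))⁻¹ : ℝ) : ℂ) * (((Real.sqrt (|t k| / 2))⁻¹ : ℝ) : ℂ)) / 2))
        (diagonal fun _ => (1 / 2 : ℂ))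
        (diagonal fun k => I * ((t k / |t k| : ℝ) : ℂ) * ((((Real.sqrt (|t k| / 2))⁻¹ : ℝ) : ℂ) * (((Real.sqrt (|t k| / 2))⁻¹ : ℝ) : ℂ)) / 2) := by
  have hρ : ∀ k, ((Real.sqrt (|t k| / 2) : ℂ))⁻¹ * (Real.sqrt (|t k| / 2) : ℂ) = 1 := fun k =>
    inv_mul_cancel₀ (by exact_mod_cast (Real.sqrt_pos.2 (by have := ht k; positivity)).ne')
  rw [show (0 : Matrix (Fin 2) (Fin 2) ℂ) = diagonal fun _ => (0 : ℂ) from diagonal_zero.symm, diagonal_neg, blockDiagonal_mul]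
  simp only [mul_zero, add_zero, zero_add]
  congr 1 <;> (congr 1; funext k)
  · push_cast; linear_combination (1 / 2 : ℂ) * hρ k
  · push_cast; ring
  · push_cast; linear_combination (1 / 2 : ℂ) * hρ k
  · push_cast; ring

/-- the slot letters of (9)(10): `γ_k · γ′_k = −1` (`ρ′ρ = 1`, `sg² = 1`). [folklore] -/
theorem gamma_mul_gammaInv (t : Fin 2 → ℝ) (ht : ∀ k, t k ≠ 0) (k : Fin 2) :
    I * ((t k / |t k| : ℝ) : ℂ) * ((Real.sqrt (|t k| / 2) : ℂ) * (Real.sqrt (|t k| / 2) : ℂ)) *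
      (I * ((t k / |t k| : ℝ) : ℂ) * ((((Real.sqrt (|t k| / 2))⁻¹ : ℝ) : ℂ) * (((Real.sqrt (|t k| / 2))⁻¹ : ℝ) : ℂ))) = -1 := by
  have h1 : Real.sqrt (|t k| / 2) ≠ 0 := (Real.sqrt_pos.2 (by have := ht k; positivity)).ne'
  have hρ : (((Real.sqrt (|t k| / 2))⁻¹ : ℝ) : ℂ) * (Real.sqrt (|t k| / 2) : ℂ) = 1 := by
    rw [← ofReal_mul, inv_mul_cancel₀ h1, ofReal_one]
  have hs : ((t k / |t k| : ℝ) : ℂ) * ((t k / |t k| : ℝ) : ℂ) = 1 := by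
    rw [← ofReal_mul, ← ofReal_one, div_mul_div_comm, ← sq, ← sq, sq_abs, div_self (pow_ne_zero 2 (ht k))]
  obtain ⟨hc, hτ⟩ := slot_letters hρ hs
  linear_combination ((Real.sqrt (|t k| / 2) : ℂ) * (Real.sqrt (|t k| / 2) : ℂ) *
      ((((Real.sqrt (|t k| / 2))⁻¹ : ℝ) : ℂ) * (((Real.sqrt (|t k| / 2))⁻¹ : ℝ) : ℂ))) * hc + (-1 : ℂ) * hτ

/-- `map` commutes with `reindex` (definitional). [folklore] -/
theorem map_reindex {l m l' m' α β : Type*} (eₘ : m ≃ m') (eₗ : l ≃ l') (M : Matrix m l α) (f : α → β) :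
    (Matrix.reindex eₘ eₗ M).map f = Matrix.reindex eₘ eₗ (M.map f) := rfl

variable (L : Type) [Field L] [NumberField L] [IsCMField L]
variable (eV : Fin 2 × Fin 1 ≃ Fin 2) (eA eB : Fin 1 × Fin 1 ≃ Fin 1)
  (dA : Fin 1 → L) (hdA : ∀ i, IsCMField.complexConj L (dA i) = dA i)
  (dB : Fin 1 → L) (hdB : ∀ i, IsCMField.complexConj L (dB i) = dB i)
  (dV : Fin 2 → L) (hdV : ∀ i, IsCMField.complexConj L (dV i) = dV i)
  (hVA : ∀ i, dV (Fin.castAdd 1 i) = dA i) (hVB : ∀ j, dV (Fin.natAdd 1 j) = dB j)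
  (dW : Fin 1 → L) (hdW : ∀ i, IsCMField.complexConj L (dW i) = dW i)
  (ι : Matrix (Fin 1 ⊕ Fin 1) (Fin 1 ⊕ Fin 1) ℂ → Matrix (Fin 2 ⊕ Fin 2) (Fin 2 ⊕ Fin 2) ℂ)
  (hι : ∀ x, ι x = fromBlocks !![1, 0; 0, x (Sum.inl 0) (Sum.inl 0)] !![0, 0; 0, x (Sum.inl 0) (Sum.inr 0)] !![0, 0; 0, x (Sum.inr 0) (Sum.inl 0)] !![1, 0; 0, x (Sum.inr 0) (Sum.inr 0)])

omit [NumberField L] [IsCMField L] in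
include hVB in
/-- with `eV (1,0) = 1` the slot-`1` gram letter of `V` is the `B`-line's: `dV (eV⁻¹ 1).1 · dW (eV⁻¹ 1).2 = dB 0 · dW 0`. [cite: Kudla1994, §2] -/
theorem dVdW_slot_one (he : eV (1, 0) = 1) : dV (eV.symm 1).1 * dW (eV.symm 1).2 = dB 0 * dW 0 := by
  rw [(eV_symm_of_he eV he).1]
  exact congrArg (· * dW 0) (hVB 0)

include hι in
/-- **THE ARCHIMEDEAN COMPONENT OF THE CORNER CHART IS THE CORNER**: for every complex place `σ` and every `y ∈ H_B(𝔸)`,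
`e₂⁻¹ · ((blkD(1,y))_∞)_σ · e₂ = ι(e₂⁻¹ · (y_∞)_σ · e₂)` (★ (e2) `coe_archPart_blkD_inr`: the chart commutes with the archimedean component; ★ `coe_archAt_eq_map`: the
`σ`-component is entrywise; §2: the shuffle is the corner when `eV (1,0) = 1`). [cite: Kudla1994, §2] [cite: BorelJacquet1979, §4.1] -/
theorem reindex_archAt_blkD_one (he : eV (1, 0) = 1) (σ : {w : InfinitePlace L // w.IsComplex}) (hw : IsCMField.complexConj L • σ.1 = σ.1)
    (y : HA L eB dB hdB dW hdW) :
    Matrix.reindex (finSumFinEquiv (m := 2) (n := 2)).symm (finSumFinEquiv (m := 2) (n := 2)).symm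
        (((UnitaryGroup.archAt (Fp L) L (IsCMField.complexConj L) (2 + 2) (hermD L eV dV hdV dW hdW) σ hw (IsCMField.complexConj_ne_one L)
            (UnitaryGroup.archPart (Fp L) L (IsCMField.complexConj L) (2 + 2) (hermD L eV dV hdV dW hdW)
              (blkD L eV eA eB dA hdA dB hdB dV hdV hVA hVB dW hdW (1, y))) :
            UnitaryGroup.archLocal L (2 + 2) (hermD L eV dV hdV dW hdW) σ) : GL (Fin (2 + 2)) ℂ) : Matrix (Fin (2 + 2)) (Fin (2 + 2)) ℂ) =
      ι (Matrix.reindex (finSumFinEquiv (m := 1) (n := 1)).symm (finSumFinEquiv (m := 1) (n := 1)).symm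
        (((UnitaryGroup.archAt (Fp L) L (IsCMField.complexConj L) (1 + 1) (hermD L eB dB hdB dW hdW) σ hw (IsCMField.complexConj_ne_one L)
            (UnitaryGroup.archPart (Fp L) L (IsCMField.complexConj L) (1 + 1) (hermD L eB dB hdB dW hdW) y) :
            UnitaryGroup.archLocal L (1 + 1) (hermD L eB dB hdB dW hdW) σ) : GL (Fin (1 + 1)) ℂ) : Matrix (Fin (1 + 1)) (Fin (1 + 1)) ℂ)) := by
  rw [K2LiuSiegelUnipotentArchPlaces.coe_archAt_eq_map L eV dV hdV dW hdW σ hw, K2LiuSiegelUnipotentArchPlaces.coe_archAt_eq_map L eB dB hdB dW hdW σ hw,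
    K2LiuBlockDiagPlaces.coe_archPart_blkD_inr L eV eA eB dA hdA dB hdB dV hdV hVA hVB dW hdW y, UnitaryGroup.coe_reindexGL, UnitaryGroup.coe_blockDiagGL]
  dsimp only
  rw [Units.val_one, map_reindex, Matrix.fromBlocks_map, Matrix.map_zero _ (map_zero _), Matrix.map_one _ (map_zero _) (map_one _)]
  exact reindex_blockDiag_one_eq_corner eV ι hι eA eB he _

include hι in
/-- **HEAD — THE CORNER IN THE ADAPTED FRAME.**  At the Levi-ADAPTED frames of ★ p864905 `K2LiuKindOneLineLeviFramesOfRecord.exists_leviFrames_of_record` BY VALUE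
(closed forms (9)(10) as `hTdef hTinvdef`, letters `t_k(σ) = Re σ(dV_{eV⁻¹k,1}·dW_{eV⁻¹k,2})` non-zero — ★ `tw_ne_zero`), with `eV (1,0) = 1`: for every complex `σ` and `y ∈ H_B(𝔸)`,
`T′σ · (e₂⁻¹·((blkD(1,y))_∞)_σ·e₂) · T′σ⁻¹ = ι(T′₁σ · (e₂⁻¹·(y_∞)_σ·e₂) · T′₁σ⁻¹)` where `T′₁σ = [[1, 1],[γ, −γ]]`, `T′₁σ⁻¹ = [[½, −γ′∕2],[½, γ′∕2]]` is the slot-`1` frame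
(`γ = i·sg·ρ²`, `γ′ = i·sg·ρ′²` at `t := t_1(σ)`; §1 `slotFrame_mul_slotFrameInv`, `slotFrame_conj_weyl`, `slotFrame_conj_unip` then apply with `c := i·sg`, `τ := ρ²`).
[cite: Kudla1994, §2] [cite: Shimura1997, §18.1 (18.4), §A3] [cite: BorelJacquet1979, §4.1] -/
theorem frame_archAt_blkD_one_adapted (he : eV (1, 0) = 1)
    (T Tinv : {w : InfinitePlace L // w.IsComplex} → Matrix (Fin 2 ⊕ Fin 2) (Fin 2 ⊕ Fin 2) ℂ)
    (hTdef : ∀ σ, T σ = Matrix.fromBlocks (diagonal (fun k => (((Real.sqrt (|(σ.1.embedding (dV (eV.symm k).1 * dW (eV.symm k).2)).re| / 2))⁻¹ : ℝ) : ℂ))) 0 0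
          (diagonal (fun k => (Real.sqrt (|(σ.1.embedding (dV (eV.symm k).1 * dW (eV.symm k).2)).re| / 2) : ℂ))) *
        fromBlocks (diagonal (fun k => (Real.sqrt (|(σ.1.embedding (dV (eV.symm k).1 * dW (eV.symm k).2)).re| / 2) : ℂ)))
          (diagonal (fun k => (Real.sqrt (|(σ.1.embedding (dV (eV.symm k).1 * dW (eV.symm k).2)).re| / 2) : ℂ)))
          (diagonal (fun k => I * ((((σ.1.embedding (dV (eV.symm k).1 * dW (eV.symm k).2)).re / |(σ.1.embedding (dV (eV.symm k).1 * dW (eV.symm k).2)).re|) *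
            Real.sqrt (|(σ.1.embedding (dV (eV.symm k).1 * dW (eV.symm k).2)).re| / 2) : ℝ) : ℂ)))
          (-diagonal (fun k => I * ((((σ.1.embedding (dV (eV.symm k).1 * dW (eV.symm k).2)).re / |(σ.1.embedding (dV (eV.symm k).1 * dW (eV.symm k).2)).re|) *
            Real.sqrt (|(σ.1.embedding (dV (eV.symm k).1 * dW (eV.symm k).2)).re| / 2) : ℝ) : ℂ))))
    (hTinvdef : ∀ σ, Tinv σ = fromBlocks (diagonal (fun k => (((Real.sqrt (|(σ.1.embedding (dV (eV.symm k).1 * dW (eV.symm k).2)).re| / 2))⁻¹ / 2 : ℝ) : ℂ)))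
          (-diagonal (fun k => I * (((Real.sqrt (|(σ.1.embedding (dV (eV.symm k).1 * dW (eV.symm k).2)).re| / 2))⁻¹ *
            ((σ.1.embedding (dV (eV.symm k).1 * dW (eV.symm k).2)).re / |(σ.1.embedding (dV (eV.symm k).1 * dW (eV.symm k).2)).re|) / 2 : ℝ) : ℂ)))
          (diagonal (fun k => (((Real.sqrt (|(σ.1.embedding (dV (eV.symm k).1 * dW (eV.symm k).2)).re| / 2))⁻¹ / 2 : ℝ) : ℂ)))
          (diagonal (fun k => I * (((Real.sqrt (|(σ.1.embedding (dV (eV.symm k).1 * dW (eV.symm k).2)).re| / 2))⁻¹ *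
            ((σ.1.embedding (dV (eV.symm k).1 * dW (eV.symm k).2)).re / |(σ.1.embedding (dV (eV.symm k).1 * dW (eV.symm k).2)).re|) / 2 : ℝ) : ℂ))) *
        Matrix.fromBlocks (diagonal (fun k => (Real.sqrt (|(σ.1.embedding (dV (eV.symm k).1 * dW (eV.symm k).2)).re| / 2) : ℂ))) 0 0
          (diagonal (fun k => (((Real.sqrt (|(σ.1.embedding (dV (eV.symm k).1 * dW (eV.symm k).2)).re| / 2))⁻¹ : ℝ) : ℂ))))
    (σ : {w : InfinitePlace L // w.IsComplex}) (hw : IsCMField.complexConj L • σ.1 = σ.1)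
    (ht : ∀ k, (σ.1.embedding (dV (eV.symm k).1 * dW (eV.symm k).2)).re ≠ 0) (y : HA L eB dB hdB dW hdW) :
    T σ * Matrix.reindex (finSumFinEquiv (m := 2) (n := 2)).symm (finSumFinEquiv (m := 2) (n := 2)).symm
        (((UnitaryGroup.archAt (Fp L) L (IsCMField.complexConj L) (2 + 2) (hermD L eV dV hdV dW hdW) σ hw (IsCMField.complexConj_ne_one L)
            (UnitaryGroup.archPart (Fp L) L (IsCMField.complexConj L) (2 + 2) (hermD L eV dV hdV dW hdW)
              (blkD L eV eA eB dA hdA dB hdB dV hdV hVA hVB dW hdW (1, y))) :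
            UnitaryGroup.archLocal L (2 + 2) (hermD L eV dV hdV dW hdW) σ) : GL (Fin (2 + 2)) ℂ) : Matrix (Fin (2 + 2)) (Fin (2 + 2)) ℂ) * Tinv σ =
      ι ((fromBlocks !![1] !![1]
            !![I * (((σ.1.embedding (dV (eV.symm 1).1 * dW (eV.symm 1).2)).re / |(σ.1.embedding (dV (eV.symm 1).1 * dW (eV.symm 1).2)).re| : ℝ) : ℂ) *
              ((Real.sqrt (|(σ.1.embedding (dV (eV.symm 1).1 * dW (eV.symm 1).2)).re| / 2) : ℂ) * (Real.sqrt (|(σ.1.embedding (dV (eV.symm 1).1 * dW (eV.symm 1).2)).re| / 2) : ℂ))]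
            !![-(I * (((σ.1.embedding (dV (eV.symm 1).1 * dW (eV.symm 1).2)).re / |(σ.1.embedding (dV (eV.symm 1).1 * dW (eV.symm 1).2)).re| : ℝ) : ℂ) *
              ((Real.sqrt (|(σ.1.embedding (dV (eV.symm 1).1 * dW (eV.symm 1).2)).re| / 2) : ℂ) * (Real.sqrt (|(σ.1.embedding (dV (eV.symm 1).1 * dW (eV.symm 1).2)).re| / 2) : ℂ)))] :
            Matrix (Fin 1 ⊕ Fin 1) (Fin 1 ⊕ Fin 1) ℂ) *
          Matrix.reindex (finSumFinEquiv (m := 1) (n := 1)).symm (finSumFinEquiv (m := 1) (n := 1)).symm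
            (((UnitaryGroup.archAt (Fp L) L (IsCMField.complexConj L) (1 + 1) (hermD L eB dB hdB dW hdW) σ hw (IsCMField.complexConj_ne_one L)
                (UnitaryGroup.archPart (Fp L) L (IsCMField.complexConj L) (1 + 1) (hermD L eB dB hdB dW hdW) y) :
                UnitaryGroup.archLocal L (1 + 1) (hermD L eB dB hdB dW hdW) σ) : GL (Fin (1 + 1)) ℂ) : Matrix (Fin (1 + 1)) (Fin (1 + 1)) ℂ) *
        fromBlocks !![1 / 2]
          !![-(I * (((σ.1.embedding (dV (eV.symm 1).1 * dW (eV.symm 1).2)).re / |(σ.1.embedding (dV (eV.symm 1).1 * dW (eV.symm 1).2)).re| : ℝ) : ℂ) *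
            ((((Real.sqrt (|(σ.1.embedding (dV (eV.symm 1).1 * dW (eV.symm 1).2)).re| / 2))⁻¹ : ℝ) : ℂ) *
              (((Real.sqrt (|(σ.1.embedding (dV (eV.symm 1).1 * dW (eV.symm 1).2)).re| / 2))⁻¹ : ℝ) : ℂ)) / 2)]
          !![1 / 2]
          !![I * (((σ.1.embedding (dV (eV.symm 1).1 * dW (eV.symm 1).2)).re / |(σ.1.embedding (dV (eV.symm 1).1 * dW (eV.symm 1).2)).re| : ℝ) : ℂ) *
            ((((Real.sqrt (|(σ.1.embedding (dV (eV.symm 1).1 * dW (eV.symm 1).2)).re| / 2))⁻¹ : ℝ) : ℂ) *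
              (((Real.sqrt (|(σ.1.embedding (dV (eV.symm 1).1 * dW (eV.symm 1).2)).re| / 2))⁻¹ : ℝ) : ℂ)) / 2]) := by
  rw [reindex_archAt_blkD_one L eV eA eB dA hdA dB hdB dV hdV hVA hVB dW hdW ι hι he σ hw y, hTdef, hTinvdef,
    adaptedFrame_eq_blockDiagonal _ ht, adaptedFrameInv_eq_blockDiagonal _ ht]
  have h11 := gamma_mul_gammaInv (fun k => (σ.1.embedding (dV (eV.symm k).1 * dW (eV.symm k).2)).re) ht 0
  exact blockDiagonalFrame_conj_corner ι hι _ _ _ _ _ _ _ _ (by norm_num) (by ring) (by ring) (by linear_combination (-1 : ℂ) * h11) _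

end Adapted

end Summit.HodgeConjecture.HodgeConjecture.Cruxes.HLiu418.K2LiuKindOneLineCornerFrameReading

end
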